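import Literature.MathematicalPhysics.QuantumLattice.HubbardEffectiveActionCTSpinCharge
import Literature.Probability.LatticeModels.TorusFourierProofs
import HarnessLib

/-!
# Space-time translations of the countertermed Hubbard effective action (no pair seed) as frequency–momentum charge scalings,
# and the selection rule: kernels CONSERVE the Matsubara index sum and the lattice momentum

Topic `MathematicalPhysics/QuantumLattice`; companion of `HubbardEffectiveActionCTSpinCharge.lean` (the spin-resolved `U(1)` scaling
`ψ̂^±_{k,σ} ↦ z_σ^{±1} ψ̂^±_{k,σ}` and its selection rule) and of `GrassmannChargeScaling.lean` (`map_mulLeft_effAction_of_invariant`,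
`prod_mul_kernel_of_invariant`).  Benfatto–Giuliani–Mastropietro 2006 §2.1: the free measure and the interaction are invariant under
space-time translations; in momentum space a translation by `(t, a⃗)` multiplies `ψ̂^±_k` by `e^{±i(k₀t + k⃗·a⃗)}` — a CHARGE SCALING with a
momentum-dependent weight.  Here, for any weight `φ : FreqMomentum L M → ℂ` that is nowhere zero and MULTIPLICATIVE ON THE CONSERVATION LAW
of the Hubbard vertex (`φ k₁ φ k₃ = φ k₂ φ k₄` whenever `n₁ + n₃ = n₂ + n₄` and `k⃗₁ + k⃗₃ = k⃗₂ + k⃗₄`), the scaling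
`c(((k,σ),+)) = φ k`, `c(((k,σ),−)) = (φ k)⁻¹` (written inline, no definition):

* `map_freqMomCharge_psiPlus/psiMinus`, `map_freqMomCharge_hubbardInteraction`, `map_freqMomCharge_counterQuadratic`,
  **`map_freqMomCharge_hubbardInteractionCT`** — `V_K` is invariant; `freqMomCharge_mul_hubbardTwoPointCT`, `…CovarianceCT`, `…CovAboveCT` —
  at seed `h = 0` the covariance pairs only `ψ̂⁺_{kσ}` with `ψ̂⁻_{kσ}`, so `c(X) c(Y) C^K_{>Λ}(X,Y) = C^K_{>Λ}(X,Y)`;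
  **`map_freqMomCharge_hubbardEffectiveActionCT`**, **`prod_freqMomCharge_mul_kernel_hubbardEffectiveActionCT`** — `S_c 𝒢^K_Λ = 𝒢^K_Λ` at `h = 0`
  and `(∏ᵢ c(Xᵢ)) · F_m(X) = F_m(X)`;
* the SELECTION RULES (weights `2^{index}` resp. the characters `χ_a(k⃗)` of the dual torus):
  **`kernel_hubbardEffectiveActionCT_eq_zero_of_matsubaraIdx_sum_ne`** — `F_m(X) = 0` unless the Matsubara INDEX sums over the `ψ̂⁺` legs and over
  the `ψ̂⁻` legs agree; **`kernel_hubbardEffectiveActionCT_eq_zero_of_momentum_sum_ne`** — `F_m(X) = 0` unless `Σ_{+} k⃗ᵢ = Σ_{−} k⃗ᵢ` in `(ℤ/Lℤ)²`;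
* two legs: **`kernel_hubbardEffectiveActionCT_two_eq_ite`** — on EVERY label string `((σ₀,c₀),(σ₁,c₁))`,
  `F_2((k₀,σ₀,c₀),(k₁,σ₁,c₁)) = [k₀ = k₁]·F_2((k₀,σ₀,c₀),(k₀,σ₁,c₁))` (normal strings by the two conservation laws, anomalous strings `c₀ = c₁` vanish
  identically by the `U(1)` rule `kernel_hubbardEffectiveActionCT_eq_zero_of_spinCharge`) — the «conserving-diagonal» form of the two-leg kernel.

Everything is proved; no definitions.  Source: G. Benfatto, A. Giuliani, V. Mastropietro, Ann. Henri Poincaré 7 (2006) 809, §2.1 (symmetries of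
`P(dψ)` and `𝒱`), §2.3 (2.17) [`BenfattoGiulianiMastropietro2006`].
-/

noncomputable section

namespace Literature.MathematicalPhysics.QuantumLattice

open Literature.Probability.LatticeModels GrassmannAlgebra Finset

section Fields

variable (L M : ℕ) (φ : FreqMomentum L M → ℂ)

/-- The scaling on `ψ̂⁺`: `ψ̂⁺_{k,σ} ↦ φ(k) ψ̂⁺_{k,σ}`. [cite: BenfattoGiulianiMastropietro2006, §2.1] -/
theorem map_freqMomCharge_psiPlus (k : FreqMomentum L M) (s : Fin 2) :
    (ExteriorAlgebra.map (LinearMap.mulLeft ℂ (fun X : HubbardFieldIdx L M => if X.2 = 0 then φ X.1.1 else (φ X.1.1)⁻¹))) (psiPlus k s) =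
      φ k • psiPlus k s := by
  unfold psiPlus
  rw [map_mulLeft_gen]
  simp

/-- The scaling on `ψ̂⁻`: `ψ̂⁻_{k,σ} ↦ φ(k)⁻¹ ψ̂⁻_{k,σ}`. [cite: BenfattoGiulianiMastropietro2006, §2.1] -/
theorem map_freqMomCharge_psiMinus (k : FreqMomentum L M) (s : Fin 2) :
    (ExteriorAlgebra.map (LinearMap.mulLeft ℂ (fun X : HubbardFieldIdx L M => if X.2 = 0 then φ X.1.1 else (φ X.1.1)⁻¹))) (psiMinus k s) =
      (φ k)⁻¹ • psiMinus k s := by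
  unfold psiMinus
  rw [map_mulLeft_gen]
  simp

variable {φ} (hφ0 : ∀ k, φ k ≠ 0)
include hφ0

/-- The scaling is by units: `c⁻¹ · c = 1` pointwise. [cite: BenfattoGiulianiMastropietro2006, §2.1] -/
theorem freqMomCharge_inv_mul :
    (fun X : HubbardFieldIdx L M => ((fun X : HubbardFieldIdx L M => if X.2 = 0 then φ X.1.1 else (φ X.1.1)⁻¹) X)⁻¹) *
      (fun X : HubbardFieldIdx L M => if X.2 = 0 then φ X.1.1 else (φ X.1.1)⁻¹) = 1 := by
  funext X
  simp only [Pi.mul_apply, Pi.one_apply]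
  split_ifs with h
  · exact inv_mul_cancel₀ (hφ0 _)
  · exact inv_mul_cancel₀ (inv_ne_zero (hφ0 _))

variable [NeZero L]
variable (hφ : ∀ k₁ k₂ k₃ k₄ : FreqMomentum L M,
  matsubaraInt M k₁.1 + matsubaraInt M k₃.1 = matsubaraInt M k₂.1 + matsubaraInt M k₄.1 → k₁.2 + k₃.2 = k₂.2 + k₄.2 → φ k₁ * φ k₃ = φ k₂ * φ k₄)
include hφ

/-- **The Hubbard vertex is invariant under a frequency–momentum charge scaling**: every monomial `ψ̂⁺_{k₁↑}ψ̂⁻_{k₂↑}ψ̂⁺_{k₃↓}ψ̂⁻_{k₄↓}` on the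
conservation law picks up `φ(k₁)φ(k₂)⁻¹φ(k₃)φ(k₄)⁻¹ = 1`. [cite: BenfattoGiulianiMastropietro2006, §2.1] -/
theorem map_freqMomCharge_hubbardInteraction (β U : ℝ) :
    (ExteriorAlgebra.map (LinearMap.mulLeft ℂ (fun X : HubbardFieldIdx L M => if X.2 = 0 then φ X.1.1 else (φ X.1.1)⁻¹))) (hubbardInteraction L M β U) =
      hubbardInteraction L M β U := by
  rw [hubbardInteraction, map_smul]
  congr 1
  rw [map_sum]
  refine Finset.sum_congr rfl fun k₁ _ => ?_
  rw [map_sum]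
  refine Finset.sum_congr rfl fun k₂ _ => ?_
  rw [map_sum]
  refine Finset.sum_congr rfl fun k₃ _ => ?_
  rw [map_sum]
  refine Finset.sum_congr rfl fun k₄ _ => ?_
  split_ifs with hcons
  · rw [map_mul, map_mul, map_mul, map_freqMomCharge_psiPlus, map_freqMomCharge_psiMinus, map_freqMomCharge_psiPlus,
      map_freqMomCharge_psiMinus]
    simp only [Algebra.smul_mul_assoc, Algebra.mul_smul_comm, smul_smul]
    have hw : (φ k₄)⁻¹ * (φ k₃ * ((φ k₂)⁻¹ * φ k₁)) = 1 := by
      have h13 := hφ k₁ k₂ k₃ k₄ hcons.1 hcons.2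
      field_simp [hφ0 k₂, hφ0 k₄]
      linear_combination h13
    rw [hw, one_smul]
  · exact map_zero _

omit hφ in
/-- **The counterterm vertex is invariant** (`ψ̂⁺_{kσ}ψ̂⁻_{kσ}` has weight `φ(k)φ(k)⁻¹ = 1`). [cite: BenfattoGiulianiMastropietro2006, §2.1] -/
theorem map_freqMomCharge_counterQuadratic (β : ℝ) (K : TrigPolyC4v) :
    (ExteriorAlgebra.map (LinearMap.mulLeft ℂ (fun X : HubbardFieldIdx L M => if X.2 = 0 then φ X.1.1 else (φ X.1.1)⁻¹))) (counterQuadratic L M β K) =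
      counterQuadratic L M β K := by
  rw [counterQuadratic, map_sum]
  refine Finset.sum_congr rfl fun k _ => ?_
  rw [map_sum]
  refine Finset.sum_congr rfl fun s _ => ?_
  rw [map_smul, map_mul, map_freqMomCharge_psiPlus, map_freqMomCharge_psiMinus]
  simp only [Algebra.smul_mul_assoc, Algebra.mul_smul_comm, smul_smul, inv_mul_cancel₀ (hφ0 k), mul_one]

/-- **The interaction slot `V_K` is invariant under a frequency–momentum charge scaling.** [cite: BenfattoGiulianiMastropietro2006, §2.1] -/
theorem map_freqMomCharge_hubbardInteractionCT (β U : ℝ) (K : TrigPolyC4v) :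
    (ExteriorAlgebra.map (LinearMap.mulLeft ℂ (fun X : HubbardFieldIdx L M => if X.2 = 0 then φ X.1.1 else (φ X.1.1)⁻¹))) (hubbardInteractionCT L M β U K) =
      hubbardInteractionCT L M β U K := by
  rw [hubbardInteractionCT, map_add, map_freqMomCharge_hubbardInteraction L M hφ0 hφ, map_freqMomCharge_counterQuadratic L M hφ0]

omit [NeZero L] hφ in
/-- **The seedless CT two-point table carries total weight one**: `c(X) c(Y) ⟨ψ_X ψ_Y⟩₀^K = ⟨ψ_X ψ_Y⟩₀^K` at `h = 0` (the table pairs only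
`ψ̂⁺_{kσ}` with `ψ̂⁻_{kσ}`). [cite: BenfattoGiulianiMastropietro2006, §2.1] -/
theorem freqMomCharge_mul_hubbardTwoPointCT (β μ : ℝ) (K : TrigPolyC4v) (X Y : HubbardFieldIdx L M) :
    (fun X : HubbardFieldIdx L M => if X.2 = 0 then φ X.1.1 else (φ X.1.1)⁻¹) X *
        (fun X : HubbardFieldIdx L M => if X.2 = 0 then φ X.1.1 else (φ X.1.1)⁻¹) Y * hubbardTwoPointCT L M β μ 0 K X Y =
      hubbardTwoPointCT L M β μ 0 K X Y := by
  obtain ⟨⟨k, s⟩, c⟩ := X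
  obtain ⟨⟨k', s'⟩, c'⟩ := Y
  by_cases hk : k = k'
  · subst hk
    fin_cases s <;> fin_cases s' <;> fin_cases c <;> fin_cases c' <;>
      simp [hubbardTwoPointCT, toNambu, nambuTwoPointCT, mul_inv_cancel₀ (hφ0 _), inv_mul_cancel₀ (hφ0 _)]
  · have hk' : ¬ k' = k := fun h => hk h.symm
    have hkn : ¬ k.neg = k'.neg := fun h => hk (by simpa using congrArg FreqMomentum.neg h)
    have hkn' : ¬ k'.neg = k.neg := fun h => hk' (by simpa using congrArg FreqMomentum.neg h)
    fin_cases s <;> fin_cases s' <;> fin_cases c <;> fin_cases c' <;>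
      simp [hubbardTwoPointCT, toNambu, nambuTwoPointCT, hk, hk', hkn, hkn']

omit [NeZero L] hφ in
/-- The seedless CT covariance carries total weight one: `c(X) c(Y) C^K(X,Y) = C^K(X,Y)`. [cite: BenfattoGiulianiMastropietro2006, §2.1] -/
theorem freqMomCharge_mul_hubbardCovarianceCT (β μ : ℝ) (K : TrigPolyC4v) (X Y : HubbardFieldIdx L M) :
    (fun X : HubbardFieldIdx L M => if X.2 = 0 then φ X.1.1 else (φ X.1.1)⁻¹) X *
        (fun X : HubbardFieldIdx L M => if X.2 = 0 then φ X.1.1 else (φ X.1.1)⁻¹) Y * hubbardCovarianceCT L M β μ 0 K X Y =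
      hubbardCovarianceCT L M β μ 0 K X Y := by
  simp only [hubbardCovarianceCT, Matrix.of_apply, mul_neg, freqMomCharge_mul_hubbardTwoPointCT L M hφ0]

omit [NeZero L] hφ in
/-- **The seedless CT covariance above scale `Λ` carries total weight one**: `c(X) c(Y) C^K_{>Λ}(X,Y) = C^K_{>Λ}(X,Y)` — translation invariance of
the Gaussian integration. [cite: BenfattoGiulianiMastropietro2006, §2.1] -/
theorem freqMomCharge_mul_hubbardCovAboveCT (β μ : ℝ) (K : TrigPolyC4v) (Λ : ℝ) (X Y : HubbardFieldIdx L M) :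
    (fun X : HubbardFieldIdx L M => if X.2 = 0 then φ X.1.1 else (φ X.1.1)⁻¹) X *
        (fun X : HubbardFieldIdx L M => if X.2 = 0 then φ X.1.1 else (φ X.1.1)⁻¹) Y * hubbardCovAboveCT L M β μ 0 K Λ X Y =
      hubbardCovAboveCT L M β μ 0 K Λ X Y := by
  have h := freqMomCharge_mul_hubbardCovarianceCT L M hφ0 β μ K X Y
  simp only [hubbardCovAboveCT, Matrix.of_apply]
  conv_rhs => rw [← h]
  ring

/-- **A frequency–momentum charge scaling is a symmetry of the seedless countertermed effective action**: `S_c 𝒢^K_Λ = 𝒢^K_Λ` at `h = 0`,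
every frame, every scale. [cite: BenfattoGiulianiMastropietro2006, §2.1] -/
theorem map_freqMomCharge_hubbardEffectiveActionCT (β U μ : ℝ) (K : TrigPolyC4v) (Λ : ℝ) :
    (ExteriorAlgebra.map (LinearMap.mulLeft ℂ (fun X : HubbardFieldIdx L M => if X.2 = 0 then φ X.1.1 else (φ X.1.1)⁻¹)))
        (hubbardEffectiveActionCT L M β U μ 0 K Λ) = hubbardEffectiveActionCT L M β U μ 0 K Λ :=
  map_mulLeft_effAction_of_invariant ℂ (freqMomCharge_inv_mul L M hφ0) (freqMomCharge_mul_hubbardCovAboveCT L M hφ0 β μ K Λ)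
    (map_freqMomCharge_hubbardInteractionCT L M hφ0 hφ β U K)

/-- **The kernels of the seedless countertermed effective action carry total frequency–momentum weight one**:
`(∏ᵢ c(Xᵢ)) · F_m(X) = F_m(X)`. [cite: BenfattoGiulianiMastropietro2006, §2.1] -/
theorem prod_freqMomCharge_mul_kernel_hubbardEffectiveActionCT (β U μ : ℝ) (K : TrigPolyC4v) (Λ : ℝ) (m : ℕ)
    (X : Fin m → HubbardFieldIdx L M) :
    (∏ i, (fun X : HubbardFieldIdx L M => if X.2 = 0 then φ X.1.1 else (φ X.1.1)⁻¹) (X i)) * kernel ℂ (hubbardEffectiveActionCT L M β U μ 0 K Λ) m X =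
      kernel ℂ (hubbardEffectiveActionCT L M β U μ 0 K Λ) m X :=
  prod_mul_kernel_of_invariant ℂ (fun X : HubbardFieldIdx L M => if X.2 = 0 then φ X.1.1 else (φ X.1.1)⁻¹)
    (map_freqMomCharge_hubbardEffectiveActionCT L M hφ0 hφ β U μ K Λ) m X

end Fields

/-! ### The selection rules: conservation of the Matsubara index sum and of the lattice momentum -/

section Selection

variable (L M : ℕ) [NeZero L]

/-- A character of the dual torus is multiplicative over finite sums: `χ_a(Σᵢ xᵢ) = ∏ᵢ χ_a(xᵢ)`. [cite: FriedliVelenik2017, §10.4] -/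
theorem torusChar_finset_sum_right {d : ℕ} {ι : Type*} (a : TorusSite d L) (s : Finset ι) (x : ι → TorusSite d L) :
    torusChar a (∑ i ∈ s, x i) = ∏ i ∈ s, torusChar a (x i) := by
  classical
  induction s using Finset.induction_on with
  | empty => simp
  | insert i s hi ih => rw [Finset.sum_insert hi, Finset.prod_insert hi, torusChar_add_right, ih]

/-- The inverse of a character value is its value at the opposite point: `χ_a(x)⁻¹ = χ_a(−x)`. [cite: FriedliVelenik2017, §10.4] -/
theorem torusChar_inv_eq_neg {d : ℕ} (a x : TorusSite d L) : (torusChar a x)⁻¹ = torusChar a (-x) := by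
  rw [torusChar_neg_right]
  exact (eq_inv_of_mul_eq_one_right (torusChar_mul_conj a x)).symm

/-- **Selection rule I (time translations): the kernels of the seedless countertermed effective action conserve the Matsubara INDEX sum** —
`F_m(X) = 0` unless `Σ_{i : cᵢ = +} nᵢ = Σ_{i : cᵢ = −} nᵢ` (indices `nᵢ ∈ [0, 2M)`; weight `φ(k) = 2^{n}`, multiplicative on the vertex's conservation law
`n₁ + n₃ = n₂ + n₄`). [cite: BenfattoGiulianiMastropietro2006, §2.1] -/
theorem kernel_hubbardEffectiveActionCT_eq_zero_of_matsubaraIdx_sum_ne (β U μ : ℝ) (K : TrigPolyC4v) (Λ : ℝ) {m : ℕ}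
    (X : Fin m → HubbardFieldIdx L M)
    (hne : (∑ i, if (X i).2 = 0 then ((X i).1.1.1 : ℕ) else 0) ≠ ∑ i, if (X i).2 = 0 then 0 else ((X i).1.1.1 : ℕ)) :
    kernel ℂ (hubbardEffectiveActionCT L M β U μ 0 K Λ) m X = 0 := by
  set φ : FreqMomentum L M → ℂ := fun k => (2 : ℂ) ^ ((k.1 : ℕ)) with hφ_def
  have hφ0 : ∀ k, φ k ≠ 0 := fun k => pow_ne_zero _ two_ne_zero
  have hφ : ∀ k₁ k₂ k₃ k₄ : FreqMomentum L M, matsubaraInt M k₁.1 + matsubaraInt M k₃.1 = matsubaraInt M k₂.1 + matsubaraInt M k₄.1 →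
      k₁.2 + k₃.2 = k₂.2 + k₄.2 → φ k₁ * φ k₃ = φ k₂ * φ k₄ := by
    intro k₁ k₂ k₃ k₄ h _
    have h' : (k₁.1 : ℕ) + (k₃.1 : ℕ) = (k₂.1 : ℕ) + (k₄.1 : ℕ) := by
      simp only [matsubaraInt] at h
      omega
    simp only [hφ_def, ← pow_add, h']
  have hinv := prod_freqMomCharge_mul_kernel_hubbardEffectiveActionCT L M hφ0 hφ β U μ K Λ m X
  have hprod : (∏ i, (fun X : HubbardFieldIdx L M => if X.2 = 0 then φ X.1.1 else (φ X.1.1)⁻¹) (X i)) =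
      (2 : ℂ) ^ (∑ i, if (X i).2 = 0 then ((X i).1.1.1 : ℕ) else 0) * ((2 : ℂ)⁻¹) ^ (∑ i, if (X i).2 = 0 then 0 else ((X i).1.1.1 : ℕ)) := by
    have hterm : ∀ i, (fun X : HubbardFieldIdx L M => if X.2 = 0 then φ X.1.1 else (φ X.1.1)⁻¹) (X i) =
        (2 : ℂ) ^ (if (X i).2 = 0 then ((X i).1.1.1 : ℕ) else 0) * ((2 : ℂ)⁻¹) ^ (if (X i).2 = 0 then 0 else ((X i).1.1.1 : ℕ)) := by
      intro i
      by_cases hc : (X i).2 = 0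
      · simp [hφ_def, hc]
      · simp [hφ_def, hc, inv_pow]
    simp_rw [hterm]
    rw [Finset.prod_mul_distrib, Finset.prod_pow_eq_pow_sum, Finset.prod_pow_eq_pow_sum]
  rw [hprod] at hinv
  have hw : (2 : ℂ) ^ (∑ i, if (X i).2 = 0 then ((X i).1.1.1 : ℕ) else 0) * ((2 : ℂ)⁻¹) ^ (∑ i, if (X i).2 = 0 then 0 else ((X i).1.1.1 : ℕ)) ≠ 1 :=
    fun h => hne (two_pow_mul_inv_two_pow_eq_one h)
  have h' : ((2 : ℂ) ^ (∑ i, if (X i).2 = 0 then ((X i).1.1.1 : ℕ) else 0) * ((2 : ℂ)⁻¹) ^ (∑ i, if (X i).2 = 0 then 0 else ((X i).1.1.1 : ℕ)) - 1) *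
      kernel ℂ (hubbardEffectiveActionCT L M β U μ 0 K Λ) m X = 0 := by
    rw [sub_mul, one_mul, hinv, sub_self]
  exact (mul_eq_zero.1 h').resolve_left (sub_ne_zero.2 hw)

/-- **Selection rule II (space translations): the kernels of the seedless countertermed effective action conserve the lattice momentum** —
`F_m(X) = 0` unless `Σᵢ s_{cᵢ} k⃗ᵢ = 0` in `(ℤ/Lℤ)²` (weights: the characters `χ_a(k⃗)` of the dual torus, `a ∈ (ℤ/Lℤ)²`; character orthogonality
separates the points). [cite: BenfattoGiulianiMastropietro2006, §2.1] -/
theorem kernel_hubbardEffectiveActionCT_eq_zero_of_momentum_sum_ne (β U μ : ℝ) (K : TrigPolyC4v) (Λ : ℝ) {m : ℕ}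
    (X : Fin m → HubbardFieldIdx L M) (hne : (∑ i, if (X i).2 = 0 then (X i).1.1.2 else -(X i).1.1.2) ≠ 0) :
    kernel ℂ (hubbardEffectiveActionCT L M β U μ 0 K Λ) m X = 0 := by
  -- some character does not vanish on the total signed momentum
  set Ktot : TorusSite 2 L := ∑ i, if (X i).2 = 0 then (X i).1.1.2 else -(X i).1.1.2 with hK_def
  obtain ⟨a, ha⟩ : ∃ a : TorusSite 2 L, torusChar a Ktot ≠ 1 := by
    by_contra h
    push Not at h
    have hsum := sum_torusChar_left Ktot
    rw [if_neg hne] at hsum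
    have : ∑ k : TorusSite 2 L, torusChar k Ktot = (Fintype.card (TorusSite 2 L) : ℂ) := by
      rw [Finset.sum_congr rfl fun k _ => h k, Finset.sum_const, Finset.card_univ, nsmul_eq_mul, mul_one]
    rw [this] at hsum
    exact (Nat.cast_ne_zero.2 Fintype.card_ne_zero) hsum
  set φ : FreqMomentum L M → ℂ := fun k => torusChar a k.2 with hφ_def
  have hφ0 : ∀ k, φ k ≠ 0 := fun k => by
    simp only [hφ_def]; exact fun h0 => by simpa [h0] using norm_torusChar a k.2
  have hφ : ∀ k₁ k₂ k₃ k₄ : FreqMomentum L M, matsubaraInt M k₁.1 + matsubaraInt M k₃.1 = matsubaraInt M k₂.1 + matsubaraInt M k₄.1 →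
      k₁.2 + k₃.2 = k₂.2 + k₄.2 → φ k₁ * φ k₃ = φ k₂ * φ k₄ := by
    intro k₁ k₂ k₃ k₄ _ h
    simp only [hφ_def, ← torusChar_add_right, h]
  have hinv := prod_freqMomCharge_mul_kernel_hubbardEffectiveActionCT L M hφ0 hφ β U μ K Λ m X
  have hprod : (∏ i, (fun X : HubbardFieldIdx L M => if X.2 = 0 then φ X.1.1 else (φ X.1.1)⁻¹) (X i)) = torusChar a Ktot := by
    have hterm : ∀ i, (fun X : HubbardFieldIdx L M => if X.2 = 0 then φ X.1.1 else (φ X.1.1)⁻¹) (X i) =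
        torusChar a (if (X i).2 = 0 then (X i).1.1.2 else -(X i).1.1.2) := by
      intro i
      by_cases hc : (X i).2 = 0
      · simp [hφ_def, hc]
      · simp [hφ_def, hc, torusChar_inv_eq_neg]
    simp_rw [hterm]
    rw [hK_def, torusChar_finset_sum_right]
  rw [hprod] at hinv
  have h' : (torusChar a Ktot - 1) * kernel ℂ (hubbardEffectiveActionCT L M β U μ 0 K Λ) m X = 0 := by
    rw [sub_mul, one_mul, hinv, sub_self]
  exact (mul_eq_zero.1 h').resolve_left (sub_ne_zero.2 ha)

/-- **Two legs: the `2`-kernel of the seedless countertermed effective action is CONSERVING-DIAGONAL on every label string** —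
`F_2((k₀,σ₀,c₀),(k₁,σ₁,c₁)) = [k₀ = k₁]·F_2((k₀,σ₀,c₀),(k₀,σ₁,c₁))`: off the diagonal a normal string (`c₀ ≠ c₁`) violates one of the two conservation
laws, and an anomalous string (`c₀ = c₁`) vanishes identically by the `U(1)` selection rule `kernel_hubbardEffectiveActionCT_eq_zero_of_spinCharge`.
[cite: BenfattoGiulianiMastropietro2006, §2.3 (2.17)] -/
theorem kernel_hubbardEffectiveActionCT_two_eq_ite (β U μ : ℝ) (K : TrigPolyC4v) (Λ : ℝ) (τ : Fin 2 → Fin 2 × Fin 2)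
    (k : Fin 2 → FreqMomentum L M) :
    kernel ℂ (hubbardEffectiveActionCT L M β U μ 0 K Λ) 2 (fun i => ((k i, (τ i).1), (τ i).2)) =
      if k 0 = k 1 then kernel ℂ (hubbardEffectiveActionCT L M β U μ 0 K Λ) 2 (fun i => ((k 0, (τ i).1), (τ i).2)) else 0 := by
  classical
  by_cases hk : k 0 = k 1
  · rw [if_pos hk]
    congr 1
    funext i
    fin_cases i
    · rfl
    · simp [hk]
  rw [if_neg hk]
  by_cases hc : (τ 0).2 = (τ 1).2
  · -- anomalous string: the spin of leg `0` has unequal numbers of `+` and `−` legs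
    refine kernel_hubbardEffectiveActionCT_eq_zero_of_spinCharge L M β U μ K Λ _ (τ 0).1 ?_
    obtain h0 | h0 : (τ 0).2 = 0 ∨ (τ 0).2 = 1 := Fin.exists_fin_two.mp ⟨(τ 0).2, rfl⟩
    · have h1 : (τ 1).2 = 0 := hc ▸ h0
      have hempty : (Finset.univ.filter fun i : Fin 2 => ((fun i => (((k i, (τ i).1), (τ i).2) : HubbardFieldIdx L M)) i).1.2 = (τ 0).1 ∧
          ((fun i => (((k i, (τ i).1), (τ i).2) : HubbardFieldIdx L M)) i).2 = 1) = ∅ := by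
        refine Finset.filter_eq_empty_iff.mpr fun i _ => ?_
        fin_cases i <;> simp [h0, h1]
      have hpos : (Finset.univ.filter fun i : Fin 2 => ((fun i => (((k i, (τ i).1), (τ i).2) : HubbardFieldIdx L M)) i).1.2 = (τ 0).1 ∧
          ((fun i => (((k i, (τ i).1), (τ i).2) : HubbardFieldIdx L M)) i).2 = 0).card ≠ 0 := by
        refine Finset.card_ne_zero.mpr ⟨0, ?_⟩
        simp [h0]
      rw [hempty, Finset.card_empty]
      exact hpos
    · have h1 : (τ 1).2 = 1 := hc ▸ h0
      have hempty : (Finset.univ.filter fun i : Fin 2 => ((fun i => (((k i, (τ i).1), (τ i).2) : HubbardFieldIdx L M)) i).1.2 = (τ 0).1 ∧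
          ((fun i => (((k i, (τ i).1), (τ i).2) : HubbardFieldIdx L M)) i).2 = 0) = ∅ := by
        refine Finset.filter_eq_empty_iff.mpr fun i _ => ?_
        fin_cases i <;> simp [h0, h1]
      have hpos : (Finset.univ.filter fun i : Fin 2 => ((fun i => (((k i, (τ i).1), (τ i).2) : HubbardFieldIdx L M)) i).1.2 = (τ 0).1 ∧
          ((fun i => (((k i, (τ i).1), (τ i).2) : HubbardFieldIdx L M)) i).2 = 1).card ≠ 0 := by
        refine Finset.card_ne_zero.mpr ⟨0, ?_⟩
        simp [h0]
      rw [hempty, Finset.card_empty]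
      exact hpos.symm
  · -- normal string: one of the two conservation laws is violated off the diagonal
    have hcases : ((τ 0).2 = 0 ∧ (τ 1).2 = 1) ∨ ((τ 0).2 = 1 ∧ (τ 1).2 = 0) := by
      obtain h0 | h0 : (τ 0).2 = 0 ∨ (τ 0).2 = 1 := Fin.exists_fin_two.mp ⟨(τ 0).2, rfl⟩ <;>
        obtain h1 | h1 : (τ 1).2 = 0 ∨ (τ 1).2 = 1 := Fin.exists_fin_two.mp ⟨(τ 1).2, rfl⟩
      · exact absurd (h0.trans h1.symm) hc
      · exact Or.inl ⟨h0, h1⟩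
      · exact Or.inr ⟨h0, h1⟩
      · exact absurd (h0.trans h1.symm) hc
    by_cases hk1 : (k 0).1 = (k 1).1
    · -- the spatial momenta differ
      have hk2 : (k 0).2 ≠ (k 1).2 := fun h => hk (Prod.ext hk1 h)
      refine kernel_hubbardEffectiveActionCT_eq_zero_of_momentum_sum_ne L M β U μ K Λ _ ?_
      rw [Fin.sum_univ_two]
      rcases hcases with ⟨h0, h1⟩ | ⟨h0, h1⟩
      · simp only [h0, h1, if_true, one_ne_zero, if_false]
        exact fun h => hk2 (sub_eq_zero.mp (by rwa [sub_eq_add_neg]))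
      · simp only [h0, h1, if_true, one_ne_zero, if_false]
        exact fun h => hk2 (neg_add_eq_zero.mp h)
    · -- the Matsubara indices differ
      refine kernel_hubbardEffectiveActionCT_eq_zero_of_matsubaraIdx_sum_ne L M β U μ K Λ _ ?_
      rw [Fin.sum_univ_two, Fin.sum_univ_two]
      have hk1' : ((k 0).1 : ℕ) ≠ ((k 1).1 : ℕ) := fun h => hk1 (Fin.ext h)
      rcases hcases with ⟨h0, h1⟩ | ⟨h0, h1⟩
      · simp only [h0, h1, if_true, one_ne_zero, if_false, add_zero, zero_add]
        exact hk1'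
      · simp only [h0, h1, if_true, one_ne_zero, if_false, add_zero, zero_add]
        exact fun h => hk1' h.symm

end Selection

end Literature.MathematicalPhysics.QuantumLattice

end
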